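import HarnessLib
import Summits.CriticalPhenomena.Ising3DConformalLimit.Theorems.HarmonicMomentsIsotropyTwoPointAsymptoticIsotropySeqKernel
import Summits.CriticalPhenomena.Ising3DConformalLimit.Theorems.HarmonicMomentsIsotropyTwoPointAsymptoticIsotropyRayScaling
import Summits.CriticalPhenomena.Ising3DConformalLimit.Theorems.HarmonicMomentsIsotropyTwoPointAsymptoticIsotropyOfPairLimit

/-!
# Vague asymptotic isotropy of the critical `ℤ³` two-point function, XXIX:
# RAY REGULAR VARIATION SUFFICES — scale covariance along lattice rays forces isotropy
(route HarmonicMomentsIsotropy, support item stmt-CriticalPhenomena-6036 `TwoPointAsymptoticIsotropy`;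
main file of the ray-regular-variation line of seat c4)

Write `G = criticalTwoPoint 3` for the critical two-point function `⟨σ₀σ_x⟩_{β_c}` of the
nearest-neighbour Ising model on `ℤ³`.

**Theorem** (`twoPointAsymptoticIsotropy_of_rayRegularVariation`). Suppose only that `G` is REGULARLY
VARYING ALONG EVERY LATTICE RAY with a common index: for some `a`, every `x ∈ ℤ³ ∖ {0}` and every
`k ≥ 1`, `G(k m x) / G(m x) → k^{-a}` as `m → ∞`. Then `G` is asymptotically `O(3)`-invariant in the
vague sense (`TwoPointAsymptoticIsotropy`): for every continuous compactly supported `φ ≥ 0`, `φ ≢ 0`,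
on `ℝ³` and every `R ∈ O(3)`, `Σ_x φ(Rx/L) G(x) / Σ_x φ(x/L) G(x) → 1` as `L → ∞`.

The hypothesis is PURELY RADIAL — it compares `G` at two points of the same ray only, and says nothing
about the angular profile `x̂ ↦ G(x)`, which is the output: on `ℤ³`, continuous scale covariance of the
critical two-point function already forces its rotation invariance. Mechanism
(`kernel_eq_rpow_of_rayRV`, `pairLimit_of_rayRV`):
1. on the axis ray the hypothesis gives the dyadic doubling ratio, hence `TwoPointDoubling` (item 6150)
   and `UniformRegularity` (item 4658) of the pinned zoom by the tree's reflection-positivity pedigree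
   machinery, hence SUBSEQUENTIAL locally uniform limits of the pinned pair zoom along every mesh
   sequence (file XXVIII);
2. the kernel `K = S₂(0,·)` of every such cluster point is continuous, positive, `K(e₀) = 1`,
   nine-mirror invariant and nine-mirror reflection positive (file XXVII: lattice RP of FILS 1978
   passed to the limit along the sequence) and — the one place where the hypothesis enters beyond
   doubling — HOMOGENEOUS of degree `-a` with `1 ≤ a ≤ 2` (file XXVIII / XXVIII-W);
3. nine-mirror RP rigidity (`HRP2Rigidity_of`, crux of route HyperoctahedralRP, proved in the tree)
   makes `K` `O(3)`-invariant, so `K = ‖·‖^{-a}`: ALL cluster points coincide;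
4. precompactness plus uniqueness of the cluster point give convergence of the pinned pair zoom along
   the full filter `δ → 0⁺` to `‖z₁ − z₀‖^{-a}`, and the pair-only conditional theorem
   `twoPointAsymptoticIsotropy_of_pairLimit` (file XIV) concludes.

Conversely (`rayRV_of_pairLimit`) any pair scaling limit gives ray regular variation, so the new
hypothesis is EQUIVALENT to the existence of the two-point scaling limit (`rayRV_iff_pairLimit`) and is
implied by each earlier upstream of the item: the existence crux `ExistsScaleCovariantLimit` (item
1981), the isotropic power law `IsingEuclidUpgradeR2RotInvPowerLaw` (item 0634) and `PointwiseLimit`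
(item 6153) (`rayRV_of_existsScaleCovariantLimit`, `rayRV_of_rotInvPowerLaw`, `rayRV_of_pointwiseLimit`).
The unconditional milestone stays open (Duminil-Copin, ICM 2022, §8.1, §8.4: neither the rotation
invariance nor the regular variation — existence of `η` — of `⟨σ₀σ_x⟩_{β_c}` is known on `ℤ³`).

References: H. Duminil-Copin, ICM 2022, §8.1, §8.4 [DuminilCopinICM2022]; J. Fröhlich, R. Israel,
E. H. Lieb, B. Simon, Comm. Math. Phys. 62 (1978), §3 [FrohlichEtAl1978]; N. H. Bingham, C. M. Goldie,
J. L. Teugels, *Regular Variation* (CUP 1987), §1.9. No definitions are introduced (`RayRV[a]` is a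
local notation).
-/

noncomputable section

namespace Summit.CriticalPhenomena.Ising3DConformalLimit.HarmonicMomentsIsotropyTwoPoint.RayRV

open Literature.Probability.LatticeModels Filter Set
open scoped Topology
open Summit.CriticalPhenomena.Ising3DConformalLimit.MoebiusLimitExistsOnlyInteraction (rhoPin rhoPin_pos)
open Summit.CriticalPhenomena.Ising3DConformalLimit.MoebiusLimitExistsNegative (tendsto_div_succ_nhdsGT)
open Summit.CriticalPhenomena.Ising3DConformalLimit.HyperoctahedralRPTwoPoint
open Summit.CriticalPhenomena.Ising3DConformalLimit.Theses.HarmonicMomentsIsotropy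
open Summit.CriticalPhenomena.Ising3DConformalLimit.Theses
open Summit.CriticalPhenomena.Ising3DConformalLimit.Cruxes.ExistsScaleCovariantLimit.TwoHierarchies
  (crux_iff_pointwiseLimit)

/-- `RayRV[a]`: RAY REGULAR VARIATION of the critical two-point function with exponent `a` — on every
lattice ray `ℕ·x`, `x ∈ ℤ³ ∖ {0}`, `⟨σ₀σ_{kmx}⟩_{β_c} / ⟨σ₀σ_{mx}⟩_{β_c} → k^{-a}` as `m → ∞`, for every
`k ≥ 1` (local notation, no new definition). -/
local notation3 (prettyPrint := false) "RayRV[" a "]" =>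
  ∀ x : Site 3, x ≠ 0 → ∀ k : ℕ, 1 ≤ k →
    Tendsto (fun m : ℕ => criticalTwoPoint 3 (fun i => ((k * m : ℕ) : ℤ) * x i) /
      criticalTwoPoint 3 (fun i => ((m : ℕ) : ℤ) * x i)) atTop (𝓝 ((k : ℝ) ^ (-a)))

/-- `PairLimit`: the renormalised critical pair correlator converges, for some renormalisation `ρ > 0`
on `(0,1]`, locally uniformly off the diagonal along `δ → 0⁺`, to a function positive there — the
hypothesis of file XIV `twoPointAsymptoticIsotropy_of_pairLimit` (local notation, no new definition). -/
local notation3 (prettyPrint := false) "PairLimit" =>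
  ∃ (ρ : ℝ → ℝ) (S2 : (Fin 2 → EuclideanSpace ℝ (Fin 3)) → ℝ),
    (∀ δ ∈ Set.Ioc (0:ℝ) 1, 0 < ρ δ) ∧
    TendstoLocallyUniformlyOn (rescaledCorrelator (criticalCorr 3) ρ 2) S2 (𝓝[>] (0:ℝ))
      (NonCoincident 3 2) ∧
    ∀ z ∈ NonCoincident 3 2, 0 < S2 z

/-! ### Every cluster kernel is the pure power `‖·‖^{-a}` -/

/-- **Under ray regular variation every sequential limit of the pinned pair zoom has the kernel
`S₂(0, y) = ‖y‖^{-a}`.** Normalise `S₂` off `NonCoincident`; its kernel is continuous, positive off `0`,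
homogeneous of degree `-a` (`kernel_homogeneous_of_rayRV`) with `1 ≤ a ≤ 2`
(`exponent_mem_Icc_of_rayRV`), nine-mirror invariant and reflection positive (`kernel_nineMirror_seq`),
hence `O(3)`-invariant by nine-mirror RP rigidity (`HRP2Rigidity_of`); a reflection maps `e₀` to
`y/‖y‖`, homogeneity scales, and `S₂(0, e₀) = 1` by the pinning. [cite: DuminilCopinICM2022, §8.1] -/
theorem kernel_eq_rpow_of_rayRV {a : ℝ} (hRV : RayRV[a]) {u : ℕ → ℝ}
    (hu : Tendsto u atTop (𝓝[>] (0 : ℝ))) {S2 : (Fin 2 → EuclideanSpace ℝ (Fin 3)) → ℝ}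
    (hconv2 : TendstoLocallyUniformlyOn (fun k => rescaledCorrelator (criticalCorr 3) rhoPin 2 (u k)) S2
      atTop (NonCoincident 3 2))
    (hpos : ∀ z ∈ NonCoincident 3 2, 0 < S2 z)
    {y : EuclideanSpace ℝ (Fin 3)} (hy : y ≠ 0) :
    S2 ![0, y] = ‖y‖ ^ (-a) := by
  classical
  -- normalise off `NonCoincident`
  set S2' : (Fin 2 → EuclideanSpace ℝ (Fin 3)) → ℝ :=
    fun z => if z ∈ NonCoincident 3 2 then S2 z else 0 with hS2'
  have S2'_in : ∀ {z}, z ∈ NonCoincident 3 2 → S2' z = S2 z := fun hz => by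
    simp only [hS2', if_pos hz]
  have S2'_out : ∀ {z}, z ∉ NonCoincident 3 2 → S2' z = 0 := fun hz => by
    simp only [hS2', if_neg hz]
  have hconv2' : TendstoLocallyUniformlyOn
      (fun k => rescaledCorrelator (criticalCorr 3) rhoPin 2 (u k)) S2' atTop (NonCoincident 3 2) :=
    hconv2.congr_right fun z hz => (S2'_in hz).symm
  have hpos' : ∀ z ∈ NonCoincident 3 2, 0 < S2' z := fun z hz => by rw [S2'_in hz]; exact hpos z hz
  -- the kernel and its clauses
  set K : EuclideanSpace ℝ (Fin 3) → ℝ := fun w => S2' ![0, w] with hK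
  have hK0 : K 0 = 0 := by
    have h : (![0, 0] : Fin 2 → EuclideanSpace ℝ (Fin 3)) ∉ NonCoincident 3 2 := by
      rw [mem_nonCoincident]
      intro hinj
      exact absurd (@hinj 0 1 (by simp)) (by decide)
    exact S2'_out h
  have hKcont : ContinuousOn K {0}ᶜ := kernel_continuousOn_seq hu hconv2'
  have hKpos : ∀ w : EuclideanSpace ℝ (Fin 3), w ≠ 0 → 0 < K w := fun w hw =>
    hpos' _ (zero_pair_mem_nonCoincident hw)
  have hKhom : ∀ c : ℝ, 0 < c → ∀ w : EuclideanSpace ℝ (Fin 3),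
      K (c • w) = c ^ (-(2 * (a / 2))) * K w := by
    intro c hc w
    rw [show -(2 * (a / 2)) = -a by ring]
    by_cases hw : w = 0
    · subst hw
      rw [smul_zero, hK0, mul_zero]
    · exact kernel_homogeneous_of_rayRV hRV rhoPin_pos hu hconv2' hpos' hc hw
  have hKmir := fun (n : EuclideanSpace ℝ (Fin 3)) (hn : ∃ i j : Fin 3, i ≠ j ∧
      (n = EuclideanSpace.single i 1 ∨ n = EuclideanSpace.single i 1 + EuclideanSpace.single j 1 ∨
        n = EuclideanSpace.single i 1 - EuclideanSpace.single j 1)) =>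
    kernel_nineMirror_seq hu hconv2' hn
  obtain ⟨ha1, ha2⟩ := exponent_mem_Icc_of_rayRV hRV
  have hrot : ∀ (T : EuclideanSpace ℝ (Fin 3) ≃ₗᵢ[ℝ] EuclideanSpace ℝ (Fin 3))
      (w : EuclideanSpace ℝ (Fin 3)), K (T w) = K w :=
    Summit.CriticalPhenomena.Ising3DConformalLimit.Cruxes.HRP2Rigidity.XRayMellin.HRP2Rigidity_of (a / 2)
      K (by linarith) (by linarith) hKcont hKpos hKhom hKmir
  -- pinning: `K e₀ = 1`
  set v : EuclideanSpace ℝ (Fin 3) := EuclideanSpace.single 0 1 with hv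
  have hKv : K v = 1 := by
    have h1 : Tendsto (fun k => rescaledCorrelator (criticalCorr 3) rhoPin 2 (u k) ![0, v]) atTop
        (𝓝 (S2' ![0, v])) := hconv2'.tendsto_at PinnedClusterPoints.cfg01_mem
    have h2 : Tendsto (fun k => rescaledCorrelator (criticalCorr 3) rhoPin 2 (u k) ![0, v]) atTop
        (𝓝 1) := by
      simp_rw [hv, PinnedClusterPoints.rescaled_pin_cfg01]
      exact tendsto_const_nhds
    exact tendsto_nhds_unique h1 h2
  -- rotate `e₀` to `y/‖y‖` and scale
  set t : ℝ := ‖y‖ with ht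
  have htpos : 0 < t := norm_pos_iff.2 hy
  set w : EuclideanSpace ℝ (Fin 3) := t⁻¹ • y with hw
  have hvn : ‖v‖ = 1 := by simp [hv]
  have hwn : ‖w‖ = 1 := by
    rw [hw, norm_smul, norm_inv, Real.norm_of_nonneg htpos.le, ← ht, inv_mul_cancel₀ htpos.ne']
  set T := (Submodule.span ℝ {v - w})ᗮ.reflection with hT
  have hTv : T v = w := Submodule.reflection_sub (by rw [hvn, hwn])
  have hy' : T (t • v) = y := by
    rw [map_smul, hTv, hw, smul_smul, mul_inv_cancel₀ htpos.ne', one_smul]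
  have hval : S2 ![0, y] = K y := (S2'_in (zero_pair_mem_nonCoincident hy)).symm
  rw [hval, ← hy', hrot T (t • v), hKhom t htpos v, hKv, mul_one]
  congr 1
  ring

/-! ### Uniqueness of the cluster point: the pinned pair zoom converges along the full filter -/

/-- **Under ray regular variation the pinned pair zoom converges**:
`ρ_pin(δ)² ⟨σ_{[z₀/δ]} σ_{[z₁/δ]}⟩_{β_c} → ‖z₁ − z₀‖^{-a}` locally uniformly on `{z₀ ≠ z₁}` as
`δ → 0⁺`. If not, some compact set, some `ε > 0` and some mesh sequence `u k → 0⁺` (the filter is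
countably generated, `exists_seq_forall_of_frequently`) witness a defect `≥ ε`; but a subsequence
converges (`exists_seqLimit_of_uniformRegularity`, compactness from doubling) and its limit is the same
power kernel (`kernel_eq_rpow_of_rayRV`, translation invariance) — contradiction.
[cite: DuminilCopinICM2022, §8.4] -/
theorem pairLimit_of_rayRV {a : ℝ} (hRV : RayRV[a]) :
    TendstoLocallyUniformlyOn (rescaledCorrelator (criticalCorr 3) rhoPin 2)
      (fun z => ‖z 1 - z 0‖ ^ (-a)) (𝓝[>] (0:ℝ)) (NonCoincident 3 2) := by
  have hUR := uniformRegularity_of_rayRV hRV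
  rw [tendstoLocallyUniformlyOn_iff_forall_isCompact (isOpen_nonCoincident 3 2)]
  intro K hKsub hK
  rw [Metric.tendstoUniformlyOn_iff]
  intro ε hε
  by_contra hnot
  have hfreq : ∃ᶠ δ in 𝓝[>] (0:ℝ), ∃ x ∈ K,
      ε ≤ dist (‖x 1 - x 0‖ ^ (-a)) (rescaledCorrelator (criticalCorr 3) rhoPin 2 δ x) := by
    rw [Filter.not_eventually] at hnot
    refine hnot.mono fun δ hδ => ?_
    push Not at hδ
    exact hδ
  obtain ⟨u, hu, hux⟩ := exists_seq_forall_of_frequently hfreq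
  choose xs hxsK hxs using hux
  obtain ⟨φ, S, hφ, -, hconv, hSpos⟩ := exists_seqLimit_of_uniformRegularity hUR hu
  have huφ : Tendsto (u ∘ φ) atTop (𝓝[>] (0:ℝ)) := hu.comp hφ.tendsto_atTop
  have hconv2 : TendstoLocallyUniformlyOn
      (fun k => rescaledCorrelator (criticalCorr 3) rhoPin 2 ((u ∘ φ) k)) (S 2) atTop
      (NonCoincident 3 2) := hconv 2
  -- the limit along the subsequence is the power kernel
  have hS2 : ∀ z ∈ NonCoincident 3 2, S 2 z = ‖z 1 - z 0‖ ^ (-a) := by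
    intro z hz
    have hinj : Function.Injective z := hz
    have hne : z 0 ≠ z 1 := fun h => absurd (hinj h) (by decide)
    have hz' : z = ![z 0, z 1] := by
      funext i; fin_cases i <;> rfl
    rw [hz', limit_two_eq_of_sub_seq huφ hconv2 hne,
      kernel_eq_rpow_of_rayRV hRV huφ hconv2 hSpos (sub_ne_zero.2 hne.symm)]
    simp
  -- uniform convergence on `K` along the subsequence contradicts the defect
  have hunif := (tendstoLocallyUniformlyOn_iff_forall_isCompact (isOpen_nonCoincident 3 2)).1
    hconv2 K hKsub hK
  rw [Metric.tendstoUniformlyOn_iff] at hunif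
  obtain ⟨k, hk⟩ := (hunif ε hε).exists
  have h1 := hk (xs (φ k)) (hxsK (φ k))
  rw [hS2 _ (hKsub (hxsK (φ k)))] at h1
  exact absurd h1 (not_lt.2 (hxs (φ k)))

/-! ### The conditional milestone -/

/-- **Ray regular variation of the critical two-point function gives the milestone**
`TwoPointAsymptoticIsotropy` (item stmt-CriticalPhenomena-6036): the pinned pair zoom converges to the
positive kernel `‖z₁ − z₀‖^{-a}` (`pairLimit_of_rayRV`), and file XIV's
`twoPointAsymptoticIsotropy_of_pairLimit` applies. [cite: DuminilCopinICM2022, §8.1] -/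
theorem twoPointAsymptoticIsotropy_of_rayRV {a : ℝ} (hRV : RayRV[a]) : TwoPointAsymptoticIsotropy := by
  refine twoPointAsymptoticIsotropy_of_pairLimit ⟨rhoPin, _, rhoPin_pos, pairLimit_of_rayRV hRV, ?_⟩
  intro z hz
  have hinj : Function.Injective z := hz
  have hne : z 0 ≠ z 1 := fun h => absurd (hinj h) (by decide)
  exact Real.rpow_pos_of_pos (norm_pos_iff.2 (sub_ne_zero.2 hne.symm)) _

/-- **Main theorem of the line.** If the critical two-point function of the nearest-neighbour Ising
model on `ℤ³` is regularly varying along every lattice ray with a common index — for some `a`, every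
`x ∈ ℤ³ ∖ {0}` and every `k ≥ 1`, `⟨σ₀σ_{kmx}⟩_{β_c} / ⟨σ₀σ_{mx}⟩_{β_c} → k^{-a}` as `m → ∞` — then it is
asymptotically `O(3)`-invariant in the vague sense: `TwoPointAsymptoticIsotropy`
(item stmt-CriticalPhenomena-6036) holds. Scale covariance along rays forces rotation invariance, by
reflection positivity in the nine lattice mirrors (`HRP2Rigidity_of`). [cite: DuminilCopinICM2022, §8.1] -/
theorem twoPointAsymptoticIsotropy_of_rayRegularVariation
    (h : ∃ a : ℝ, ∀ x : Site 3, x ≠ 0 → ∀ k : ℕ, 1 ≤ k →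
      Tendsto (fun m : ℕ => criticalTwoPoint 3 (fun i => ((k * m : ℕ) : ℤ) * x i) /
        criticalTwoPoint 3 (fun i => ((m : ℕ) : ℤ) * x i)) atTop (𝓝 ((k : ℝ) ^ (-a)))) :
    TwoPointAsymptoticIsotropy := by
  obtain ⟨a, hRV⟩ := h
  exact twoPointAsymptoticIsotropy_of_rayRV hRV

/-! ### Converse: any pair scaling limit gives ray regular variation -/

/-- At the mesh `1/m` the rescaled lattice ray points are fixed configurations: the renormalised pair
correlator at `(0, k x̂)` is `ρ(1/m)² ⟨σ₀σ_{kmx}⟩_{β_c}`. [folklore] -/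
theorem rescaledCorrelator_inv_nat_ray (ρ : ℝ → ℝ) {m : ℕ} (hm : 1 ≤ m) (k : ℕ) (x : Site 3) :
    rescaledCorrelator (criticalCorr 3) ρ 2 (1 / (m : ℝ))
        (![0, (k : ℝ) • siteVec x] : Fin 2 → EuclideanSpace ℝ (Fin 3)) =
      ρ (1 / (m : ℝ)) ^ 2 * criticalTwoPoint 3 (fun i => ((k * m : ℕ) : ℤ) * x i) := by
  have hm0 : (0 : ℝ) < m := by exact_mod_cast hm
  have hδ : (0 : ℝ) < 1 / (m : ℝ) := by positivity
  have hcfg : (k : ℝ) • siteVec x = (1 / (m : ℝ)) • siteVec (fun i => ((k * m : ℕ) : ℤ) * x i) := by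
    rw [siteVec_intMul, smul_smul]
    congr 1
    push_cast
    field_simp
  rw [hcfg, rescaledCorrelator_zero_smul_siteVec ρ hδ]

/-- **A pair scaling limit gives ray regular variation** with `a = 2Δ`, `Δ` the automatic scaling
dimension of the pair limit (`exists_rpow_scale_and_ratio₂`): along the meshes `1/m` the lattice ratio
`G(kmx)/G(mx)` is the ratio of the renormalised pair correlator at the FIXED configurations
`(0, k x̂)` and `(0, x̂)`, which converges to `S₂(0, k x̂)/S₂(0, x̂) = k^{-2Δ}`.
[cite: DuminilCopinICM2022, §8.4] -/
theorem rayRV_of_pairLimit (h : PairLimit) : ∃ a : ℝ, RayRV[a] := by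
  obtain ⟨ρ, S2, hρ, hlim2, hnd2⟩ := h
  obtain ⟨Δ, -, hcov, -⟩ := exists_rpow_scale_and_ratio₂ hρ hlim2 hnd2
  refine ⟨2 * Δ, fun x hx k hk => ?_⟩
  have hk0 : (0 : ℝ) < k := by exact_mod_cast hk
  have hxv : siteVec x ≠ 0 := siteVec_ne_zero hx
  have hmem1 : (![0, siteVec x] : Fin 2 → EuclideanSpace ℝ (Fin 3)) ∈ NonCoincident 3 2 :=
    zero_pair_mem_nonCoincident hxv
  have hmemk : (![0, (k : ℝ) • siteVec x] : Fin 2 → EuclideanSpace ℝ (Fin 3)) ∈ NonCoincident 3 2 :=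
    zero_pair_mem_nonCoincident (smul_ne_zero hk0.ne' hxv)
  -- the meshes `1/(j+1)`
  have hmesh : Tendsto (fun j : ℕ => (1:ℝ) / ((j:ℝ) + 1)) atTop (𝓝[>] (0:ℝ)) :=
    tendsto_div_succ_nhdsGT one_pos
  have hA := (hlim2.tendsto_at hmem1).comp hmesh
  have hB := (hlim2.tendsto_at hmemk).comp hmesh
  have hApos : 0 < S2 ![0, siteVec x] := hnd2 _ hmem1
  have hQ := hB.div hA hApos.ne'
  -- the limit ratio is `k^{-2Δ}`
  have hval : S2 ![0, (k : ℝ) • siteVec x] / S2 ![0, siteVec x] = (k : ℝ) ^ (-(2 * Δ)) := by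
    have h := hcov k hk0 _ hmem1
    rw [comp_zeroPair (smul_zero _)] at h
    rw [h, mul_div_assoc, div_self hApos.ne', mul_one]
    congr 1
    ring
  rw [hval] at hQ
  -- identify the terms with the lattice ratio along `m = j + 1`, then shift the index
  have hQ' : Tendsto (fun j : ℕ => criticalTwoPoint 3 (fun i => ((k * (j + 1) : ℕ) : ℤ) * x i) /
      criticalTwoPoint 3 (fun i => (((j + 1 : ℕ)) : ℤ) * x i)) atTop (𝓝 ((k : ℝ) ^ (-(2 * Δ)))) := by
    refine hQ.congr fun j => ?_
    simp only [Function.comp_apply, Pi.div_apply]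
    have hm : 1 ≤ j + 1 := Nat.succ_le_succ (Nat.zero_le j)
    have hcast : ((j:ℝ) + 1) = ((j + 1 : ℕ) : ℝ) := by push_cast; ring
    rw [hcast, rescaledCorrelator_inv_nat_ray ρ hm k x]
    have h1 := rescaledCorrelator_inv_nat_ray ρ hm 1 x
    rw [Nat.cast_one, one_smul, one_mul] at h1
    rw [h1]
    have hρm : 0 < ρ (1 / ((j + 1 : ℕ) : ℝ)) := by
      refine hρ _ ⟨by positivity, ?_⟩
      rw [div_le_one (by positivity)]
      exact_mod_cast hm
    rw [mul_div_mul_left _ _ (pow_pos hρm 2).ne']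
  exact (tendsto_add_atTop_iff_nat (f := fun m : ℕ => criticalTwoPoint 3
    (fun i => ((k * m : ℕ) : ℤ) * x i) / criticalTwoPoint 3 (fun i => ((m : ℕ) : ℤ) * x i)) 1).1 hQ'

/-- **Ray regular variation is EQUIVALENT to the existence of the two-point scaling limit** (in the
weak sense of file XIV: some `ρ > 0`, locally uniform convergence off the diagonal, positive limit).
[cite: DuminilCopinICM2022, §8.4] -/
theorem rayRV_iff_pairLimit : (∃ a : ℝ, RayRV[a]) ↔ PairLimit := by
  constructor
  · rintro ⟨a, hRV⟩
    refine ⟨rhoPin, _, rhoPin_pos, pairLimit_of_rayRV hRV, fun z hz => ?_⟩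
    have hinj : Function.Injective z := hz
    have hne : z 0 ≠ z 1 := fun h => absurd (hinj h) (by decide)
    exact Real.rpow_pos_of_pos (norm_pos_iff.2 (sub_ne_zero.2 hne.symm)) _
  · exact rayRV_of_pairLimit

/-- Ray regular variation follows from the shared existence crux `ExistsScaleCovariantLimit`
(item stmt-CriticalPhenomena-1981). [cite: DuminilCopinICM2022, §8.4] -/
theorem rayRV_of_existsScaleCovariantLimit (hEX : ExistsScaleCovariantLimit) : ∃ a : ℝ, RayRV[a] :=
  rayRV_of_pairLimit (pairLimit_of_existsScaleCovariantLimit hEX)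

/-- Ray regular variation follows from the isotropic power law `IsingEuclidUpgradeR2RotInvPowerLaw`
(item stmt-CriticalPhenomena-0634). [cite: DuminilCopinICM2022, §8.1] -/
theorem rayRV_of_rotInvPowerLaw (hP : IsingEuclidUpgrade.IsingEuclidUpgradeR2RotInvPowerLaw) :
    ∃ a : ℝ, RayRV[a] :=
  rayRV_of_pairLimit (pairLimit_of_rotInvPowerLaw hP)

/-- Ray regular variation follows from `PointwiseLimit` (item stmt-CriticalPhenomena-6153, route
MirrorHoelderCompactness), through the tree's `crux_iff_pointwiseLimit` (item 6153 ⟺ item 1981).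
[cite: DuminilCopinICM2022, §8.4] -/
theorem rayRV_of_pointwiseLimit (hPL : MirrorHoelderCompactness.PointwiseLimit) : ∃ a : ℝ, RayRV[a] :=
  rayRV_of_existsScaleCovariantLimit (crux_iff_pointwiseLimit.2 hPL)

end Summit.CriticalPhenomena.Ising3DConformalLimit.HarmonicMomentsIsotropyTwoPoint.RayRV

end
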